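import Summits.NavierStokesRegularity.NavierStokesRegularity.Theorems.GaldiLiouvilleGateParabolicGaldiLiouvilleTightness
import Summits.NavierStokesRegularity.NavierStokesRegularity.Theorems.ScenarioCensusSteady
import Literature.Analysis.FluidPDE.EulerTimeScaling
import HarnessLib

/-!
# Blow-up scenario census, block S: sub-row S2s (steady · axisymmetric without swirl · SMOOTH `D`-solutions)
# is EXCLUDED-IN-TREE

Cell `pub/ns-census` (lead MINT INTENT S2s 2026-08-28T15:38Z on the refuter's FINDING E 15:32Z, probe
`ns-census-ref/S2smooth.lean` sha16 b88301fcd52e87c2; ORDER typer-1 g5), typer seat `ns-census-typer-1` (generation 5).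
Row S2 (`ScenarioCensusSteady.lean`: `Row_S2 := FP.KorobkovPileckasRusso2015_liouville_noSwirl`, Korobkov–Pileckas–Russo,
JMFM 17 (2015), Thm 1.1: a steady axisymmetric `D`-solution WITHOUT swirl on `ℝ³`, `U → 0` at infinity, vanishes; `U ∈ C²`,
`P ∈ C¹` in the typed fact) is EXCLUDED-IN-PRINT-NOT-TREE.  Its SMOOTH sub-cell S2s (the same binders plus `ContDiff ℝ ⊤ U`,
`ContDiff ℝ ⊤ P`) is a composition of TREE theorems — exactly the reduction stated in the KPR Addendum (JMFM 18 (2016) 207: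
the theorem «follows from [KNSS 2009]»): viscosity normalisation `Tightness.normalise`, the passage steady ⇒ bounded ancient
mild class `Tightness.steady_hypotheses` (row S1's chain, crux ParabolicGaldiLiouville of route GaldiLiouvilleGate) and the
axisymmetric no-swirl case `parabolicGaldiLiouville_axisymmetric_noSwirl` (row S1c, from KNSS 2009 Thm 5.2 = census row A3).

Contents (namespace `…Theorems.ScenarioCensus`): `Row_S2s`, `row_S2s_excluded`, the lattice `row_S2s_of_row_S2` and the
regularity reduction `row_S2_of_row_S2s_of_regularity` (S2 verbatim would follow from the steady `C² → C^∞` regularity of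
Leray profiles at rate `0`, not in the tree).  CONED file (it imports the ParabolicGaldiLiouville Theorems chain, hence route
GaldiLiouvilleGate's Theses file, as `ScenarioCensusSteady` already does).

No summit statement is proved here; S2 proper stays PRINT; nothing in this file is a claim about NS regularity beyond those
statements.
-/

-- the summit and its single problem share the name (D-0017 nested layout)
set_option linter.dupNamespace false

noncomputable section

open MeasureTheory Filter Topology Set Function
open scoped ENNReal NNReal ContDiff

namespace Summit.NavierStokesRegularity.NavierStokesRegularity.Theorems.ScenarioCensus

open Literature.Analysis Literature.Analysis.FluidPDE
open Summit.NavierStokesRegularity.NavierStokesRegularity.Theorems.ParabolicGaldiLiouville.Birth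

/-- Census sub-row S2s — (steady · axisymmetric WITHOUT swirl · SMOOTH `D`-solutions, any `ν > 0`): a Leray profile at
rate `0` (`IsLerayProfile ν 0 U P`, i.e. a steady Navier–Stokes solution) with `U`, `P` of class `C^∞`, axisymmetric without
swirl, with finite Dirichlet integral `∫ |∇U|² < ∞` and `U → 0` at infinity, vanishes — row S2's binders (the fact
`KorobkovPileckasRusso2015_liouville_noSwirl`) verbatim plus the two smoothness binders.  Value: EXCLUDED-IN-TREE
(`row_S2s_excluded`); S2 itself (`C²` / `C¹` profiles) stays PRINT. -/
def Row_S2s : Prop :=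
  ∀ ν : ℝ, 0 < ν →
    ∀ (U : EuclideanSpace ℝ (Fin 3) → EuclideanSpace ℝ (Fin 3)) (P : EuclideanSpace ℝ (Fin 3) → ℝ),
    IsLerayProfile ν 0 U P → ContDiff ℝ (⊤ : ℕ∞) U → ContDiff ℝ (⊤ : ℕ∞) P →
    IsAxisymmetric U → HasNoSwirl U →
    (∫⁻ x, ENNReal.ofReal (frobeniusNormSq (fderiv ℝ U x)) < ⊤) →
    Tendsto U (cocompact (EuclideanSpace ℝ (Fin 3))) (𝓝 0) → U = 0

/-- **Sub-row S2s is EXCLUDED-IN-TREE** (the refuter's FINDING E, probe `S2smooth.lean` b88301fcd52e87c2, re-homed):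
normalise the viscosity (`Tightness.normalise`: `W = ν⁻¹U`, `Q = ν⁻²P` solve steady NS at `ν = 1`, smooth, finite Dirichlet
integral, `W → 0`), view `W` as the time-independent ancient field `fun _ => W` — a bounded ancient mild solution, jointly
smooth, of constant enstrophy, with `L⁶` slices (`Tightness.steady_hypotheses`) — which is axisymmetric without swirl on every
slice (`IsAxisymmetric.const_smul`, `HasNoSwirl.const_smul`), so row S1c's theorem
`parabolicGaldiLiouville_axisymmetric_noSwirl` (KNSS 2009 Thm 5.2 + decay) makes it vanish; undo the normalisation
(`Tightness.eq_zero_of_inv_smul_eq_zero`).  [KPR Addendum, JMFM 18 (2016) 207; KNSS 2009 Thm 5.2] -/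
theorem row_S2s_excluded : Row_S2s := by
  intro ν hν U P hprof hU hP haxi hsw hD h0
  obtain ⟨hst, hW, hQ, hDW, h0W⟩ := Tightness.normalise hν hprof hU hP hD h0
  obtain ⟨h1, h2, h3, h4⟩ := Tightness.steady_hypotheses hst hW hQ hDW h0W
  have hz := parabolicGaldiLiouville_axisymmetric_noSwirl (fun _ => ν⁻¹ • U) h1 h2 h3 h4
    (fun _ _ => haxi.const_smul ν⁻¹) (fun _ _ => hsw.const_smul ν⁻¹) (-1) (by norm_num)
  exact Tightness.eq_zero_of_inv_smul_eq_zero hν hz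

/-- Lattice: S2 (`C²` velocity, `C¹` pressure) ⇒ S2s (smooth profiles). -/
theorem row_S2s_of_row_S2 (h : Row_S2) : Row_S2s :=
  fun ν hν U P hprof _ _ haxi hsw hD h0 => h ν hν U P hprof haxi hsw hD h0

/-- **Regularity reduction for row S2**: if every Leray profile at rate `0` which tends to `0` at infinity (hence is
bounded) is smooth together with its pressure — the classical `C² → C^∞` interior regularity of steady Navier–Stokes
solutions, NOT in the tree — then row S2 verbatim follows from `row_S2s_excluded`. -/
theorem row_S2_of_row_S2s_of_regularity
    (hreg : ∀ ν : ℝ, 0 < ν →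
      ∀ (U : EuclideanSpace ℝ (Fin 3) → EuclideanSpace ℝ (Fin 3)) (P : EuclideanSpace ℝ (Fin 3) → ℝ),
      IsLerayProfile ν 0 U P → Tendsto U (cocompact (EuclideanSpace ℝ (Fin 3))) (𝓝 0) →
      ContDiff ℝ (⊤ : ℕ∞) U ∧ ContDiff ℝ (⊤ : ℕ∞) P) :
    Row_S2 := by
  intro ν hν U P hprof haxi hsw hD h0
  obtain ⟨hU, hP⟩ := hreg ν hν U P hprof h0
  exact row_S2s_excluded ν hν U P hprof hU hP haxi hsw hD h0

end Summit.NavierStokesRegularity.NavierStokesRegularity.Theorems.ScenarioCensus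

end
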